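import Summits.Ventures.Crystal3D.Theorems.StickyWulffConstantGenericWallFloorCoaxialIff
import Summits.Ventures.Crystal3D.Theorems.StickyWulffConstantPolycrystalWulffBoundSameLattice
import Summits.Ventures.Crystal3D.Theorems.StickyWulffConstantPolycrystalWulffBoundPerSelf

/-!
# `PolycrystalWulffBound`, rung `rung_basalLamellar` — frames of a co-axially embedded grain
# (line `PolyDensity`, crux `stmt-Ventures-19482`)

Route `StickyWulffConstant` of the venture `Summits/Ventures/Crystal3D`, second prover lane (poly-p2,
gen 3).  The rung `rung_basalLamellar` (cf-p1 `PolyDensityRungsDefFree.lean`) carries frames `A_f`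
that satisfy the crux's co-axiality clause `Ax m (A f) (A g)`; in particular the SELF-clause
`Ax m (A f) (A f)`: `A_f '' Λ₀ ⊆ L '' B(σ) + s` for a Hägg word `σ` and a linear isometry `L` with
`L e₂ = m`.  This file reads off what that clause says about the grain's Wulff body:
* `cruxWulffBody_eq_image_self` — `W(A) = A '' W₁` (`W₁ = W(id)`);
* `basalMirror_apply`, `twinStacking_eq_image_basalMirror` — the mirror `R` across the horizontal
  plane in coordinates (cf. `reflection_e3_apply` of the wall lane, not imported here), and
  `Λ₀⁻ = B(−1) = R '' Λ₀`;
* `exists_frame_cruxWulffBody` — the self-clause gives `W(A) = M '' W₁` with `M e₂ = m` or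
  `M e₂ = −m` (`M = L` or `M = L ∘ R`, by `linear_image_eq_frame_of_subset`: the containment is an
  equality and `σ` is constant).
Consumed by `…BasalLamellarChimera.lean` (the chimera Brunn–Minkowski lower bound).
WHAT THIS IS NOT: the rung; nothing on perimeters; the crux is not claimed.
-/

noncomputable section

open scoped BigOperators InnerProductSpace ENNReal Pointwise
open MeasureTheory Set

namespace Summit.Ventures.Crystal3D.Theorems

open Literature.MathematicalPhysics.StatisticalMechanics (fccStacking barlowStacking IsHaggSeq)

/-! ### The crux's Wulff body is the frame image of the reference body `W₁ = W(id)` -/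

/-- `W(A) = A '' W(1)`: the crux's Wulff body in orientation `A` is the `A`-image of the reference
body. -/
theorem cruxWulffBody_eq_image_self (A : (EuclideanSpace ℝ (Fin 3)) ≃ₗᵢ[ℝ] (EuclideanSpace ℝ (Fin 3))) :
    {y : (EuclideanSpace ℝ (Fin 3)) | ∀ ν : (EuclideanSpace ℝ (Fin 3)), ⟪y, ν⟫_ℝ ≤ Real.sqrt 2 / 4 *
        ∑ᶠ w ∈ {w | w ∈ fccStacking 1 (Real.sqrt (2 / 3)) ∧ ‖w‖ = 1}, |⟪w, A.symm ν⟫_ℝ|} =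
      A '' {y : (EuclideanSpace ℝ (Fin 3)) | ∀ ν : (EuclideanSpace ℝ (Fin 3)), ⟪y, ν⟫_ℝ ≤ Real.sqrt 2 / 4 *
        ∑ᶠ w ∈ {w | w ∈ fccStacking 1 (Real.sqrt (2 / 3)) ∧ ‖w‖ = 1},
          |⟪w, (LinearIsometryEquiv.refl ℝ (EuclideanSpace ℝ (Fin 3))).symm ν⟫_ℝ|} := by
  obtain ⟨L, hL⟩ := exists_linearIsometryEquiv_unitShell_eq
  rw [cruxWulffBody_eq_image_fccWulffBody hL A,
    cruxWulffBody_eq_image_fccWulffBody hL (LinearIsometryEquiv.refl ℝ (EuclideanSpace ℝ (Fin 3))),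
    LinearIsometryEquiv.trans_refl, LinearIsometryEquiv.coe_trans, Set.image_comp]

/-! ### The basal mirror -/

/-- The mirror across the horizontal plane, `x ↦ x − 2⟪e₂, x⟫e₂`, in coordinates:
`(R x)₀ = x₀`, `(R x)₁ = x₁`, `(R x)₂ = −x₂`. -/
theorem basalMirror_apply (v : (EuclideanSpace ℝ (Fin 3))) :
    ((ℝ ∙ EuclideanSpace.single (2 : Fin 3) (1 : ℝ))ᗮ.reflection v) 0 = v 0 ∧
    ((ℝ ∙ EuclideanSpace.single (2 : Fin 3) (1 : ℝ))ᗮ.reflection v) 1 = v 1 ∧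
    ((ℝ ∙ EuclideanSpace.single (2 : Fin 3) (1 : ℝ))ᗮ.reflection v) 2 = -v 2 := by
  have he : ‖EuclideanSpace.single (2 : Fin 3) (1 : ℝ)‖ = 1 := by
    rw [PiLp.norm_single, norm_one]
  have h : (ℝ ∙ EuclideanSpace.single (2 : Fin 3) (1 : ℝ))ᗮ.reflection v =
      v - (2 * ⟪EuclideanSpace.single (2 : Fin 3) (1 : ℝ), v⟫_ℝ) •
        EuclideanSpace.single (2 : Fin 3) (1 : ℝ) := by
    rw [Submodule.reflection_orthogonal_apply, Submodule.reflection_singleton_apply, he]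
    simp only [RCLike.ofReal_real_eq_id, id_eq, one_pow, div_one, two_smul, mul_comm (2 : ℝ),
      mul_two, add_smul]
    abel
  rw [h, EuclideanSpace.inner_single_left]
  refine ⟨?_, ?_, ?_⟩
  · simp
  · simp
  · simp; ring

/-- The twin stacking `Λ₀⁻ = B(−1)` is the mirror image of `Λ₀`. -/
theorem twinStacking_eq_image_basalMirror :
    barlowStacking 1 (Real.sqrt (2 / 3)) (fun _ : ℤ => (-1 : ℤ)) =
      (ℝ ∙ EuclideanSpace.single (2 : Fin 3) (1 : ℝ))ᗮ.reflection '' fccStacking 1 (Real.sqrt (2 / 3)) := by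
  set R := (ℝ ∙ EuclideanSpace.single (2 : Fin 3) (1 : ℝ))ᗮ.reflection with hR
  have hRv : ∀ v : (EuclideanSpace ℝ (Fin 3)), R v = !₂[v 0, v 1, -v 2] := by
    intro v
    obtain ⟨h0, h1, h2⟩ := basalMirror_apply v
    ext i
    fin_cases i
    · simpa using h0
    · simpa using h1
    · simpa using h2
  ext p
  rw [mem_barlowStacking_negConst_iff]
  constructor
  · intro hp
    refine ⟨R p, ?_, ?_⟩
    · rw [hRv]; exact hp
    · exact Submodule.reflection_reflection _ p
  · rintro ⟨q, hq, rfl⟩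
    have : !₂[(R q) 0, (R q) 1, -(R q) 2] = q := by
      obtain ⟨h0, h1, h2⟩ := basalMirror_apply q
      ext i
      fin_cases i
      · simpa using h0
      · simpa using h1
      · show -(R q) 2 = q 2
        rw [hR, h2, neg_neg]
    rw [this]; exact hq

/-! ### Frames of a co-axially embedded grain -/

/-- **The self-clause of `Ax` pins the Wulff body to the Barlow frame, up to the basal mirror.**
If `A '' Λ₀ ⊆ L '' B(σ) + s` for a Hägg word `σ` and a linear isometry `L` with `L e₂ = m`, then
`W(A) = M '' W₁` for a linear isometry `M` with `M e₂ = m` or `M e₂ = −m`. -/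
theorem exists_frame_cruxWulffBody {m : (EuclideanSpace ℝ (Fin 3))} {A : (EuclideanSpace ℝ (Fin 3)) ≃ₗᵢ[ℝ] (EuclideanSpace ℝ (Fin 3))}
    (h : ∃ (L : (EuclideanSpace ℝ (Fin 3)) ≃ₗᵢ[ℝ] (EuclideanSpace ℝ (Fin 3))) (s₁ s₂ : (EuclideanSpace ℝ (Fin 3))) (σ σ' : ℤ → ℤ), IsHaggSeq σ ∧ IsHaggSeq σ' ∧
      L (EuclideanSpace.single (2 : Fin 3) (1 : ℝ)) = m ∧
      A '' fccStacking 1 (Real.sqrt (2 / 3)) ⊆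
        (fun q => L q + s₁) '' barlowStacking 1 (Real.sqrt (2 / 3)) σ ∧
      A '' fccStacking 1 (Real.sqrt (2 / 3)) ⊆
        (fun q => L q + s₂) '' barlowStacking 1 (Real.sqrt (2 / 3)) σ') :
    ∃ M : (EuclideanSpace ℝ (Fin 3)) ≃ₗᵢ[ℝ] (EuclideanSpace ℝ (Fin 3)),
      {y : (EuclideanSpace ℝ (Fin 3)) | ∀ ν : (EuclideanSpace ℝ (Fin 3)), ⟪y, ν⟫_ℝ ≤ Real.sqrt 2 / 4 *
          ∑ᶠ w ∈ {w | w ∈ fccStacking 1 (Real.sqrt (2 / 3)) ∧ ‖w‖ = 1}, |⟪w, A.symm ν⟫_ℝ|} =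
        M '' {y : (EuclideanSpace ℝ (Fin 3)) | ∀ ν : (EuclideanSpace ℝ (Fin 3)), ⟪y, ν⟫_ℝ ≤ Real.sqrt 2 / 4 *
          ∑ᶠ w ∈ {w | w ∈ fccStacking 1 (Real.sqrt (2 / 3)) ∧ ‖w‖ = 1},
            |⟪w, (LinearIsometryEquiv.refl ℝ (EuclideanSpace ℝ (Fin 3))).symm ν⟫_ℝ|} ∧
      (M (EuclideanSpace.single (2 : Fin 3) 1) = m ∨ M (EuclideanSpace.single (2 : Fin 3) 1) = -m) := by
  obtain ⟨L, s₁, -, σ, -, hσ, -, hLm, h1, -⟩ := h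
  have h1' : (fun p => A p + (0 : (EuclideanSpace ℝ (Fin 3)))) '' fccStacking 1 (Real.sqrt (2 / 3)) ⊆
      (fun q => L q + s₁) '' barlowStacking 1 (Real.sqrt (2 / 3)) σ := by
    simpa only [add_zero] using h1
  obtain ⟨-, hAeq⟩ := linear_image_eq_frame_of_subset A L 0 s₁ hσ h1'
  set R := (ℝ ∙ EuclideanSpace.single (2 : Fin 3) (1 : ℝ))ᗮ.reflection with hR
  rcases hσ 0 with h0 | h0
  · -- the frame itself
    rw [h0] at hAeq
    have hfcc : barlowStacking 1 (Real.sqrt (2 / 3)) (fun _ : ℤ => (1 : ℤ)) =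
        fccStacking 1 (Real.sqrt (2 / 3)) := rfl
    rw [hfcc] at hAeq
    refine ⟨L, ?_, Or.inl hLm⟩
    rw [wulffBody_eq_of_image_eq hAeq, cruxWulffBody_eq_image_self L]
  · -- the basal mirror of the frame
    rw [h0, twinStacking_eq_image_basalMirror, ← Set.image_comp] at hAeq
    have hAeq' : A '' fccStacking 1 (Real.sqrt (2 / 3)) = (R.trans L) '' fccStacking 1 (Real.sqrt (2 / 3)) := by
      rw [hAeq, LinearIsometryEquiv.coe_trans]
    refine ⟨R.trans L, ?_, Or.inr ?_⟩
    · rw [wulffBody_eq_of_image_eq hAeq', cruxWulffBody_eq_image_self (R.trans L)]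
    · rw [LinearIsometryEquiv.coe_trans, Function.comp_apply, hR,
        Submodule.reflection_orthogonalComplement_singleton_eq_neg, map_neg, hLm]

end Summit.Ventures.Crystal3D.Theorems

end
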